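import Literature.Geometry.DiscreteGeometry.SphericalCapKernel
import Summits.Ventures.Crystal3D.Bulk.SphereCodeCut
import HarnessLib

/-!
# Cap-cut certificates: a kernel-evaluable check of inequality (I)

Venture `Crystal3D` (cell `pub-crystal3d`, phase 2; seat p3). A cap-cut certificate
(`Literature.Geometry.DiscreteGeometry.BachocVallentin.CapCert`, the format of the cell's
`phase2/idea2/capcert/` bundles: cap level `u₀`, Gegenbauer row bases `W`, PSD factors `L_k`)
proves `CapCodeBound u₀` once its two polynomial inequalities hold:
(I) `K(u,u,1) ≤ D` on `[u₀, 1]` (univariate) and (II) `K(u,v,t) ≤ -λ` on the Gram body (trivariate),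
with `D < 11·λ` (`CapCert.card_le`). This file makes (I) a KERNEL COMPUTATION:

* exact univariate polynomial arithmetic on rational coefficient lists (`padd`, `pscale`, `pmul`,
  `ppow`, `pshift`), each with its `upolyEval` semantics;
* `diagPoly` — the coefficient list of the diagonal `K(u,u,1) = Σ_k (1-u²)^k Σ_r g_{k,r}(u)²`
  (`CapCert.kernel_diag`), with `upolyEval (diagPoly c) u = c.kernel u u 1`;
* a Taylor-form box test (`lowerBound`, `boxOK`: on `[a,b]`, with `m` the midpoint and `ρ` the
  radius, `P ≥ P̃(0) - ρ·(|P̃₁| + ρ(|P̃₂| + …))` for `P̃ = P(m + ·)`), chained over consecutive boxes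
  (`checkCover`), and `checkIneqI` with the soundness theorem
  `ineqI_of_check : checkIneqI c D pts = true → c.IneqI D`;
* the bridge to the cell's socket (`Bulk/SphereCodeCut.lean`, seat typer-bulk):
  `capCodeBound_of_capCert : 0 < λ → D < 11·λ → c.IneqI D → c.IneqII (1/2) λ → CapCodeBound c.u₀`
  and `capCodeBound_of_checkI` (with (I) replaced by its kernel check), hence `NoHole (-c.u₀)` by
  `noHole_of_capCodeBound`.

All arithmetic is in `ℚ` by structural recursion (no well-founded recursion, no floats), so
`decide +kernel` evaluates it with the standard axioms. HONEST FRAMING: bookkeeping only; (II) is NOT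
checked here (it stays a named hypothesis of the instances); nothing geometric is proved in this file.
-/

open Finset
open Literature.Geometry.DiscreteGeometry.BachocVallentin

namespace Summit.Ventures.Crystal3D.CapCut

/-! ### Univariate polynomial arithmetic on coefficient lists (lowest degree first) -/

/-- Sum of coefficient lists. [folklore] -/
def padd : List ℚ → List ℚ → List ℚ
  | [], q => q
  | a :: p, [] => a :: p
  | a :: p, b :: q => (a + b) :: padd p q

/-- `padd` is addition. [folklore] -/
theorem eval_padd (p q : List ℚ) (u : ℝ) :
    upolyEval (padd p q) u = upolyEval p u + upolyEval q u := by
  induction p generalizing q with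
  | nil => simp [padd, upolyEval]
  | cons a p ih =>
    cases q with
    | nil => simp [padd, upolyEval]
    | cons b q => simp only [padd, upolyEval, ih, Rat.cast_add]; ring

/-- Scalar multiple of a coefficient list. [folklore] -/
def pscale (c : ℚ) : List ℚ → List ℚ
  | [] => []
  | a :: p => (c * a) :: pscale c p

/-- `pscale` is scalar multiplication. [folklore] -/
theorem eval_pscale (c : ℚ) (p : List ℚ) (u : ℝ) :
    upolyEval (pscale c p) u = (c : ℝ) * upolyEval p u := by
  induction p with
  | nil => simp [pscale, upolyEval]
  | cons a p ih => simp only [pscale, upolyEval, ih, Rat.cast_mul]; ring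

/-- Product of coefficient lists. [folklore] -/
def pmul : List ℚ → List ℚ → List ℚ
  | [], _ => []
  | a :: p, q => padd (pscale a q) (0 :: pmul p q)

/-- `pmul` is multiplication. [folklore] -/
theorem eval_pmul (p q : List ℚ) (u : ℝ) :
    upolyEval (pmul p q) u = upolyEval p u * upolyEval q u := by
  induction p with
  | nil => simp [pmul, upolyEval]
  | cons a p ih =>
    simp only [pmul, eval_padd, eval_pscale, upolyEval, ih, Rat.cast_zero, zero_add]; ring

/-- Power of a coefficient list. [folklore] -/
def ppow (p : List ℚ) : ℕ → List ℚ
  | 0 => [1]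
  | n + 1 => pmul p (ppow p n)

/-- `ppow` is the power. [folklore] -/
theorem eval_ppow (p : List ℚ) (n : ℕ) (u : ℝ) :
    upolyEval (ppow p n) u = upolyEval p u ^ n := by
  induction n with
  | zero => simp [ppow, upolyEval]
  | succ n ih => rw [ppow, eval_pmul, ih, pow_succ, mul_comm]

/-- Taylor shift: the coefficient list of `P(a + x)` as a polynomial in `x`. [folklore] -/
def pshift (a : ℚ) : List ℚ → List ℚ
  | [] => []
  | c :: p => padd [c] (pmul [a, 1] (pshift a p))

/-- `pshift` is the shift `x ↦ P(a + x)`. [folklore] -/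
theorem eval_pshift (a : ℚ) (p : List ℚ) (x : ℝ) :
    upolyEval (pshift a p) x = upolyEval p (a + x) := by
  induction p with
  | nil => simp [pshift, upolyEval]
  | cons c p ih =>
    simp only [pshift, eval_padd, eval_pmul, upolyEval, ih, Rat.cast_one]; ring

/-! ### The Taylor-form box test -/

/-- Absolute value on `ℚ` by a plain `if` (kernel-friendly). [folklore] -/
def qabs (c : ℚ) : ℚ := if c < 0 then -c else c

/-- `qabs` is `|·|`. [folklore] -/
theorem qabs_cast (c : ℚ) : ((qabs c : ℚ) : ℝ) = |(c : ℝ)| := by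
  unfold qabs
  split_ifs with h
  · rw [Rat.cast_neg, abs_of_neg (by exact_mod_cast h)]
  · rw [abs_of_nonneg (by exact_mod_cast (not_lt.1 h))]

/-- `absBound p ρ = |p₀| + ρ(|p₁| + ρ(|p₂| + …))` bounds `|P(x)|` for `|x| ≤ ρ`. [folklore] -/
def absBound : List ℚ → ℚ → ℚ
  | [], _ => 0
  | c :: p, ρ => qabs c + ρ * absBound p ρ

/-- `absBound` is nonnegative for `ρ ≥ 0`. [folklore] -/
theorem absBound_nonneg (p : List ℚ) {ρ : ℚ} (hρ : 0 ≤ ρ) : 0 ≤ absBound p ρ := by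
  induction p with
  | nil => simp [absBound]
  | cons c p ih =>
    simp only [absBound]
    have : 0 ≤ qabs c := by unfold qabs; split_ifs <;> linarith
    positivity

/-- `|P(x)| ≤ absBound P ρ` for `|x| ≤ ρ`. [folklore] -/
theorem abs_eval_le_absBound (p : List ℚ) {ρ : ℚ} {x : ℝ} (hρ : 0 ≤ ρ) (hx : |x| ≤ ρ) :
    |upolyEval p x| ≤ absBound p ρ := by
  induction p with
  | nil => simp [upolyEval, absBound]
  | cons c p ih =>
    simp only [upolyEval, absBound, Rat.cast_add, Rat.cast_mul, qabs_cast]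
    have hb : (0 : ℝ) ≤ absBound p ρ := by exact_mod_cast absBound_nonneg p hρ
    calc |(c : ℝ) + x * upolyEval p x| ≤ |(c : ℝ)| + |x * upolyEval p x| := abs_add_le _ _
      _ = |(c : ℝ)| + |x| * |upolyEval p x| := by rw [abs_mul]
      _ ≤ |(c : ℝ)| + ρ * absBound p ρ := by gcongr

/-- Taylor-form lower bound of `P` on `|x| ≤ ρ`: `P(x) ≥ p₀ - ρ·absBound (tail P) ρ`. [folklore] -/
def lowerBound : List ℚ → ℚ → ℚ
  | [], _ => 0
  | c :: p, ρ => c - ρ * absBound p ρ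

/-- Soundness of `lowerBound`. [folklore] -/
theorem lowerBound_le_eval (p : List ℚ) {ρ : ℚ} {x : ℝ} (hρ : 0 ≤ ρ) (hx : |x| ≤ ρ) :
    ((lowerBound p ρ : ℚ) : ℝ) ≤ upolyEval p x := by
  cases p with
  | nil => simp [lowerBound, upolyEval]
  | cons c p =>
    simp only [lowerBound, upolyEval, Rat.cast_sub, Rat.cast_mul]
    have h := abs_eval_le_absBound p hρ hx
    have h2 : |x * upolyEval p x| ≤ ρ * absBound p ρ := by
      rw [abs_mul]
      have hb : (0 : ℝ) ≤ absBound p ρ := by exact_mod_cast absBound_nonneg p hρ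
      gcongr
    linarith [neg_abs_le (x * upolyEval p x)]

/-- Box test: `P ≥ 0` on `[a, b]` by the Taylor form at the midpoint. [folklore] -/
def boxOK (p : List ℚ) (a b : ℚ) : Bool :=
  decide (a ≤ b) && decide (0 ≤ lowerBound (pshift ((a + b) / 2) p) ((b - a) / 2))

/-- Soundness of the box test. [folklore] -/
theorem nonneg_of_boxOK (p : List ℚ) (a b : ℚ) (h : boxOK p a b = true) (x : ℝ)
    (ha : (a : ℝ) ≤ x) (hb : x ≤ b) : 0 ≤ upolyEval p x := by
  simp only [boxOK, Bool.and_eq_true, decide_eq_true_eq] at h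
  obtain ⟨hab, hlb⟩ := h
  have hρ : (0 : ℚ) ≤ (b - a) / 2 := by linarith
  have hx : |x - ((a + b) / 2 : ℚ)| ≤ (((b - a) / 2 : ℚ) : ℝ) := by
    rw [abs_le]; push_cast; constructor <;> linarith
  have h1 := lowerBound_le_eval (pshift ((a + b) / 2) p) hρ hx
  rw [eval_pshift] at h1
  have hlb' : (0 : ℝ) ≤ ((lowerBound (pshift ((a + b) / 2) p) ((b - a) / 2) : ℚ) : ℝ) := by
    exact_mod_cast hlb
  have : ((((a + b) / 2 : ℚ)) : ℝ) + (x - (((a + b) / 2 : ℚ) : ℝ)) = x := by ring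
  rw [this] at h1
  linarith

/-- Chain of box tests over `[lo, x₁], [x₁, x₂], …, [x_n, hi]`. [folklore] -/
def checkCover (p : List ℚ) : ℚ → List ℚ → ℚ → Bool
  | a₀, [], b₀ => boxOK p a₀ b₀
  | a₀, x :: rest, b₀ => boxOK p a₀ x && checkCover p x rest b₀

/-- Soundness of the chained box test: `P ≥ 0` on `[a₀, b₀]`. [folklore] -/
theorem nonneg_of_checkCover (p : List ℚ) (pts : List ℚ) :
    ∀ a₀ b₀ : ℚ, checkCover p a₀ pts b₀ = true →
      ∀ x : ℝ, (a₀ : ℝ) ≤ x → x ≤ b₀ → 0 ≤ upolyEval p x := by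
  induction pts with
  | nil =>
    intro a₀ b₀ h x ha hb
    exact nonneg_of_boxOK p a₀ b₀ h x ha hb
  | cons a rest ih =>
    intro a₀ b₀ h x ha hb
    simp only [checkCover, Bool.and_eq_true] at h
    rcases le_total x (a : ℝ) with hxa | hxa
    · exact nonneg_of_boxOK p a₀ a h.1 x ha hxa
    · exact ih a b₀ h.2 x hxa hb

/-! ### The diagonal polynomial of a certificate -/

/-- Coefficient list of `g_{k,r}` restricted to the first `n` rows: `Σ_{i<n} L_k[i][r] · w_{k,i}`.
[folklore] -/
def gPolyN (c : CapCert) (k r : ℕ) : ℕ → List ℚ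
  | 0 => []
  | n + 1 => padd (gPolyN c k r n) (pscale (c.entry k n r) (c.basis k n))

/-- Semantics of `gPolyN`. [folklore] -/
theorem eval_gPolyN (c : CapCert) (k r n : ℕ) (u : ℝ) :
    upolyEval (gPolyN c k r n) u =
      ∑ i ∈ range n, (c.entry k i r : ℝ) * upolyEval (c.basis k i) u := by
  induction n with
  | zero => simp [gPolyN, upolyEval]
  | succ n ih => rw [gPolyN, eval_padd, eval_pscale, ih, Finset.sum_range_succ]

/-- `gPolyN` at full height is `g_{k,r}`. [folklore] -/
theorem eval_gPolyN_rows (c : CapCert) (k r : ℕ) (u : ℝ) :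
    upolyEval (gPolyN c k r (c.rows k)) u = c.g k r u := by
  rw [eval_gPolyN]; rfl

/-- Coefficient list of `Σ_{r<n} g_{k,r}²`. [folklore] -/
def blockDiagN (c : CapCert) (k : ℕ) : ℕ → List ℚ
  | 0 => []
  | n + 1 => padd (blockDiagN c k n)
      (pmul (gPolyN c k n (c.rows k)) (gPolyN c k n (c.rows k)))

/-- Semantics of `blockDiagN`. [folklore] -/
theorem eval_blockDiagN (c : CapCert) (k n : ℕ) (u : ℝ) :
    upolyEval (blockDiagN c k n) u = ∑ r ∈ range n, c.g k r u ^ 2 := by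
  induction n with
  | zero => simp [blockDiagN, upolyEval]
  | succ n ih =>
    rw [blockDiagN, eval_padd, eval_pmul, ih, eval_gPolyN_rows, Finset.sum_range_succ, sq]

/-- Coefficient list of `Σ_{k<n} (1-u²)^k Σ_{r<R} g_{k,r}²`. [folklore] -/
def diagPolyN (c : CapCert) : ℕ → List ℚ
  | 0 => []
  | k + 1 => padd (diagPolyN c k) (pmul (ppow [1, 0, -1] k) (blockDiagN c k c.R))

/-- Semantics of `diagPolyN`. [folklore] -/
theorem eval_diagPolyN (c : CapCert) (n : ℕ) (u : ℝ) :
    upolyEval (diagPolyN c n) u =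
      ∑ k ∈ range n, (1 - u ^ 2) ^ k * ∑ r ∈ range c.R, c.g k r u ^ 2 := by
  induction n with
  | zero => simp [diagPolyN, upolyEval]
  | succ n ih =>
    rw [diagPolyN, eval_padd, eval_pmul, eval_ppow, ih, eval_blockDiagN, Finset.sum_range_succ]
    have h1 : upolyEval [1, 0, -1] u = 1 - u ^ 2 := by
      simp [upolyEval]; ring
    rw [h1]

/-- The DIAGONAL POLYNOMIAL of a certificate: the coefficient list of `u ↦ K(u,u,1)`.
[cite: BachocVallentin2009, Theorem 4.4 (d)] -/
def diagPoly (c : CapCert) : List ℚ := diagPolyN c c.L.length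

/-- `diagPoly` evaluates to the kernel's diagonal `K(u,u,1)`. [cite: BachocVallentin2009, Theorem 2.1] -/
theorem eval_diagPoly (c : CapCert) (u : ℝ) : upolyEval (diagPoly c) u = c.kernel u u 1 := by
  rw [diagPoly, eval_diagPolyN, CapCert.kernel_diag]

/-- KERNEL CHECK of inequality (I): `D - K(u,u,1) ≥ 0` on `[u₀, 1]`, by the chained Taylor-form box
test over the break points `pts`. [cite: BachocVallentin2009, Theorem 4.4 (d)] -/
def checkIneqI (c : CapCert) (D : ℚ) (pts : List ℚ) : Bool :=
  checkCover (padd [D] (pscale (-1) (diagPoly c))) c.u0 pts 1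

/-- **Soundness of the (I)-check**: a `true` run gives `c.IneqI D`.
[cite: BachocVallentin2009, Theorem 4.4 (d)] -/
theorem ineqI_of_check (c : CapCert) (D : ℚ) (pts : List ℚ) (h : checkIneqI c D pts = true) :
    c.IneqI D := by
  intro u hu0 hu1
  have h0 := nonneg_of_checkCover _ pts c.u0 1 h u hu0 (by exact_mod_cast hu1)
  rw [eval_padd, eval_pscale, eval_diagPoly] at h0
  simp [upolyEval] at h0
  linarith

/-! ### The bridge to `CapCodeBound` -/

/-- **A cap certificate satisfying (I) and (II) is a cap-code bound**: with `λ > 0`, `D < 11·λ`,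
`c.IneqI D` and `c.IneqII (1/2) λ`, every `60°`-code of `S²` in a cap `{x : c.u₀ ≤ e·x}` has at most
eleven points — `CapCodeBound c.u₀` of `Bulk/SphereCodeCut.lean`.
[cite: BachocVallentin2009, Theorem 4.4 (n = 3)] -/
theorem capCodeBound_of_capCert (c : CapCert) (D lam : ℚ) (hlam : 0 < lam) (hD : D < 11 * lam)
    (h1 : c.IneqI D) (h2 : c.IneqII (1 / 2) lam) : CapCodeBound (c.u0 : ℝ) := by
  intro e he T hT hsep hcap
  refine c.card_le (1 / 2) lam D 11 hlam (by exact_mod_cast hD) h1 h2 e he T hT ?_ hcap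
  intro x hx y hy hxy
  have h := hsep x hx y hy hxy
  push_cast
  exact h

/-- **Kernel form**: (I) replaced by a `true` run of `checkIneqI`; (II) stays a hypothesis.
[cite: BachocVallentin2009, Theorem 4.4 (n = 3)] -/
theorem capCodeBound_of_checkI (c : CapCert) (D lam : ℚ) (pts : List ℚ) (hlam : 0 < lam)
    (hD : D < 11 * lam) (hI : checkIneqI c D pts = true) (h2 : c.IneqII (1 / 2) lam) :
    CapCodeBound (c.u0 : ℝ) :=
  capCodeBound_of_capCert c D lam hlam hD (ineqI_of_check c D pts hI) h2

end Summit.Ventures.Crystal3D.CapCut
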